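import Literature.MathematicalPhysics.KineticTheory.LangevinChainScalingLimit
import Literature.MathematicalPhysics.KineticTheory.LangevinChainExpBound
import Literature.Analysis.ODE.LipschitzFlow
import Mathlib.Analysis.Calculus.ContDiff.RCLike
import HarnessLib

/-!
# The high-energy limit system of the pinned chain: flow, unique continuation, and the uniform dissipation bound (CEHR Prop. 5.14)

Trunk T-KINETIC (Literature/MathematicalPhysics/KineticTheory). Deterministic layer of the
provefact unit for `CuneoEckmannHairerReyBellet2018_H2` (CEHR Theorem 5.1 / Remark 5.2;
`LangevinChainDynkin.lean`, `LangevinChainH2.lean`, `LangevinChainEnergyScale.lean`).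
Cuneo–Eckmann–Hairer–Rey-Bellet, EJP 23 (2018) no. 55, §5.1 (arXiv pp. 13–14): after the
interaction scaling `p = E^{1/2}p̃`, `q = E^{1/ℓ_i}q̃`, `t = E^{1/ℓ_i-1/2}σ` the dynamics converges to
the deterministic limiting system (5.10) `dq̂ = p̂ dσ`, `dp̂ = -∇Ĥ dσ` with
`Ĥ = ∑p²/2 + δ_{ℓ_i,ℓ_p}∑U_{v,∞} + ∑V_{e,∞}`, and Prop. 5.14 asserts a uniform lower bound
`∫₀^λ ∑_b γ_b p̂_b² dσ ≥ C > 0` on the energy shell `Ĥ ∈ [1/4, 2]`, by a unique-continuation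
argument ("if `p̂_b ≡ 0` … no mass moves … only possible if `Ĥ(ẑ₀) = 0`") and compactness.
For the pinned chain (`U = ω₂q²/2 + lam q⁴/4`, `V = r²/2 + βr⁴/4`, `ℓ_i = 4`, `ℓ_p ∈ {2, 4}`) the
limit system is the chain `limitChain lam β` (`U_∞ = lam q⁴/4`, `V_∞ = βr⁴/4`, no friction), and
this file PROVES Prop. 5.14 for it:

* `limitChain`, `limitChainField`, `limitChainFlow` — the limit chain, its Hamiltonian field `Ŷ` truncated by
  a smooth radial cutoff `χ_R(z) = χ(S(z)/R²)` (`S = ∑(q_i² + p_i²)`, `χ = smoothCutoff`), and the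
  global smooth flow `Ψ_R` of `X_R = χ_R Ŷ` (`Literature.Analysis.ODE.lipschitzFlow`; `X_R` is `C^∞`
  with compact support, hence Lipschitz). Since `X_R` is a scalar multiple of `Ŷ` and `DĤ·Ŷ = 0`,
  **`Ĥ` is conserved exactly** along `Ψ_R` (`limitChain_hamiltonian_limitChainFlow`), so momenta stay
  bounded and positions move at bounded speed; hence (`phaseNormSq_limitChainFlow_le`) for data with
  `Ĥ ≤ h₀`, `|q̂_i| ≤ ρ` and `N((ρ + (h₀+½)Λ)² + (h₀+½)²) ≤ R²` the truncation is invisible on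
  `[0, Λ]`: `Ψ_R` solves (5.10) there (`hasDerivAt_limitChainFlow_drift`, `limitChainFlow_eq_add_integral`),
  and is continuous jointly in `(x̂, σ)` (`continuous_limitChainFlow`).
* `OscillatorChain.dPotential_eq_closed`, `limitChain_dPotential_eq`, `limitChain_sum_mul_dPotential`
  — closed form of the force `∂Φ/∂q_i = U'(q_i) + [1≤i]V'(q_i-q_{i-1}) - [i+1<N]V'(q_{i+1}-q_i)`
  and Euler's identity `∑ q_k ∂_kΦ̂ = 4Φ̂` for the quartic limit potential.
* `limitChain_hamiltonian_eq_zero_of_resting` — **unique continuation**: a solution of (5.10)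
  (`β > 0`, `N ≥ 1`) whose left bath momentum vanishes on `[0, Λ]`, `Λ > 0`, has zero energy
  (induction along the chain: `p̂_k ≡ 0 ⇒ q̂_k` const, `∂_kΦ̂ ≡ 0 ⇒ β(q̂_{k+1}-q̂_k)³` const ⇒
  `q̂_{k+1}` const ⇒ `p̂_{k+1} ≡ 0`; then Euler). This is CEHR's argument of Prop. 5.14 / Rem. 5.15
  (for `n = 1`, cubes are injective, so C4 is automatic, Rem. 2.10).
* `limitDissipation`, `limitDissipation_pos`, `exists_le_limitDissipation` — the dissipation
  functional `F(x̂) = ∫₀^Λ ∑_i w_i p̂_i² dσ` (`w_i = [i=0]+[i=N-1]`) is continuous, positive where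
  `Ĥ > 0`, hence **bounded below by some `ε > 0` on every compact shell
  `{h₁ ≤ Ĥ ≤ h₀, |q̂_i| ≤ ρ}`** (`h₁ > 0`) — Prop. 5.14 (for `lam = 0` the shell is used after a
  translation fixing `q̂_0`, the limit dynamics being translation invariant; that reduction is
  done by the user).

## References

* N. Cuneo, J.-P. Eckmann, M. Hairer, L. Rey-Bellet, *Non-equilibrium steady states for networks
  of oscillators*, EJP 23 (2018) no. 55 (arXiv:1712.09413), §5.1 eqs. (5.9)–(5.11), Prop. 5.14,
  Rem. 5.15, Rem. 2.10.
* S. Lang, *Differential and Riemannian Manifolds* (1995), Ch. IV §1 (flows of Lipschitz / `C^p`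
  fields), through `Literature/Analysis/ODE/LipschitzFlow.lean`.
-/

noncomputable section

open MeasureTheory Filter Topology Set Metric Function
open scoped NNReal ContDiff

namespace Literature.MathematicalPhysics.KineticTheory.HeatConduction

open OscillatorChain Literature.Analysis.ODE

variable {N : ℕ}

/-! ### The limit chain and the truncated limit field -/

/-- The **high-energy limit chain** of the pinned chain `pinnedChain ω₂ lam β γ` in the
interaction scaling `p = E^{1/2} p̃`, `q = E^{1/4} q̃`, `t = E^{-1/4} σ` (CEHR §5.1, the limit
Hamiltonian `Ĥ = ∑ p²/2 + δ_{ℓ_i,ℓ_p} ∑ U_{v,∞}(q_v) + ∑ V_{e,∞}(δq_e)`, eq. after (5.8)): quartic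
pinning `lam q⁴/4` (the limit `U_∞` of `ω₂q²/2 + lam q⁴/4`; it vanishes when `lam = 0`, i.e.
`ℓ_p = 2 < ℓ_i = 4`), quartic coupling `β r⁴/4`, and NO friction (the dissipative term scales
away, `E^{1/ℓ_i - 1/2} γ → 0`). [cite: CuneoEckmannHairerReyBellet2018, §5.1 eq. (5.9)–(5.10)] -/
def limitChain (lam β : ℝ) : OscillatorChain where
  U q := lam * q ^ 4 / 4
  V r := β * r ^ 4 / 4
  γ := 0

/-- The pinning of the limit chain is smooth. [folklore] -/
theorem limitChain_contDiff_U (lam β : ℝ) {n : WithTop ℕ∞} : ContDiff ℝ n (limitChain lam β).U := by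
  show ContDiff ℝ n fun q : ℝ => lam * q ^ 4 / 4
  fun_prop

/-- The coupling of the limit chain is smooth. [folklore] -/
theorem limitChain_contDiff_V (lam β : ℝ) {n : WithTop ℕ∞} : ContDiff ℝ n (limitChain lam β).V := by
  show ContDiff ℝ n fun r : ℝ => β * r ^ 4 / 4
  fun_prop

/-- `U_∞'(q) = lam q³`. [folklore] -/
theorem limitChain_deriv_U (lam β q : ℝ) : deriv (limitChain lam β).U q = lam * q ^ 3 := by
  show deriv (fun q : ℝ => lam * q ^ 4 / 4) q = _
  have h : HasDerivAt (fun q : ℝ => lam * q ^ 4 / 4) (lam * ((4 : ℕ) * q ^ (4 - 1)) / 4) q :=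
    (((hasDerivAt_pow 4 q).const_mul lam).div_const 4)
  rw [h.deriv]
  norm_num
  ring

/-- `V_∞'(r) = β r³`. [folklore] -/
theorem limitChain_deriv_V (lam β r : ℝ) : deriv (limitChain lam β).V r = β * r ^ 3 := by
  show deriv (fun r : ℝ => β * r ^ 4 / 4) r = _
  have h : HasDerivAt (fun r : ℝ => β * r ^ 4 / 4) (β * ((4 : ℕ) * r ^ (4 - 1)) / 4) r :=
    (((hasDerivAt_pow 4 r).const_mul β).div_const 4)
  rw [h.deriv]
  norm_num
  ring

/-- The limit Hamiltonian is smooth. [folklore] -/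
theorem limitChain_contDiff_hamiltonian (lam β : ℝ) (N : ℕ) {n : WithTop ℕ∞} :
    ContDiff ℝ n ((limitChain lam β).hamiltonian N) :=
  (limitChain lam β).contDiff_hamiltonian (limitChain_contDiff_U lam β) (limitChain_contDiff_V lam β) N

/-- The limit drift `Ŷ(q, p) = (p, -∇Φ̂(q))` is smooth. [folklore] -/
theorem limitChain_contDiff_drift (lam β : ℝ) (N : ℕ) {n : ℕ∞} :
    ContDiff ℝ n ((limitChain lam β).drift N) :=
  ((limitChain lam β).contDiff_drift (limitChain_contDiff_U lam β) (limitChain_contDiff_V lam β) N).of_le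
    (by exact_mod_cast le_top)

/-- `Ĥ ≥ ∑ p_i²/2 ≥ 0` for `lam, β ≥ 0`: the kinetic energy is bounded by the limit energy.
[folklore] -/
theorem limitChain_kinetic_le_hamiltonian {lam β : ℝ} (hl : 0 ≤ lam) (hβ : 0 ≤ β) (N : ℕ)
    (x : PhaseSpace N) : ∑ i, x.2 i ^ 2 / 2 ≤ (limitChain lam β).hamiltonian N x := by
  unfold OscillatorChain.hamiltonian
  have h1 : ∑ i, x.2 i ^ 2 / 2 ≤ ∑ i, (x.2 i ^ 2 / 2 + (limitChain lam β).U (x.1 i)) :=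
    Finset.sum_le_sum fun i _ => by simp only [limitChain]; nlinarith [mul_nonneg hl (by positivity : (0:ℝ) ≤ x.1 i ^ 4)]
  have h2 : 0 ≤ ∑ i : Fin N, ∑ j : Fin N,
      (if j.val = i.val + 1 then (limitChain lam β).V (x.1 j - x.1 i) else 0) :=
    Finset.sum_nonneg fun i _ => Finset.sum_nonneg fun j _ => by
      split_ifs
      · simp only [limitChain]; positivity
      · exact le_rfl
  linarith

/-- A single momentum is bounded by the limit energy: `|p_i| ≤ Ĥ + 1/2`. [folklore] -/
theorem limitChain_abs_momentum_le {lam β : ℝ} (hl : 0 ≤ lam) (hβ : 0 ≤ β) (N : ℕ)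
    (x : PhaseSpace N) (i : Fin N) : |x.2 i| ≤ (limitChain lam β).hamiltonian N x + 1 / 2 := by
  have h := limitChain_kinetic_le_hamiltonian hl hβ N x
  have hp : x.2 i ^ 2 / 2 ≤ ∑ j, x.2 j ^ 2 / 2 :=
    Finset.single_le_sum (f := fun j => x.2 j ^ 2 / 2) (fun j _ => by positivity) (Finset.mem_univ i)
  nlinarith [abs_le_half_add_sq_half (x.2 i), sq_abs (x.2 i)]

/-- `DĤ(y)·Ŷ(y) = 0`: the limit drift is Hamiltonian (no friction), so it conserves `Ĥ`.
[folklore] -/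
theorem limitChain_fderiv_hamiltonian_drift (lam β : ℝ) (N : ℕ) (y : PhaseSpace N) :
    fderiv ℝ ((limitChain lam β).hamiltonian N) y ((limitChain lam β).drift N y) = 0 := by
  have hH : Differentiable ℝ ((limitChain lam β).hamiltonian N) :=
    (limitChain_contDiff_hamiltonian lam β N (n := 1)).differentiable one_ne_zero
  rw [(limitChain lam β).fderiv_hamiltonian_apply hH]
  simp only [OscillatorChain.drift]
  have hγ : (limitChain lam β).γ = 0 := rfl
  simp only [hγ, zero_mul, sub_zero]
  exact Finset.sum_eq_zero fun i _ => by ring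

/-- The squared Euclidean size `S(z) = ∑_i (q_i² + p_i²)` of a phase point (a smooth substitute for
the sup norm). [folklore] -/
def phaseNormSq (z : PhaseSpace N) : ℝ := ∑ i, (z.1 i ^ 2 + z.2 i ^ 2)

/-- `S` is smooth. [folklore] -/
theorem contDiff_phaseNormSq {n : WithTop ℕ∞} : ContDiff ℝ n (phaseNormSq : PhaseSpace N → ℝ) := by
  unfold phaseNormSq
  refine ContDiff.sum fun i _ => ?_
  exact (((contDiff_apply ℝ ℝ i).comp contDiff_fst).pow 2).add
    (((contDiff_apply ℝ ℝ i).comp contDiff_snd).pow 2)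

/-- `S ≥ 0`. [folklore] -/
theorem phaseNormSq_nonneg (z : PhaseSpace N) : 0 ≤ phaseNormSq z :=
  Finset.sum_nonneg fun i _ => by positivity

/-- Each coordinate is controlled by `S`: `q_i², p_i² ≤ S(z)`. [folklore] -/
theorem sq_le_phaseNormSq (z : PhaseSpace N) (i : Fin N) :
    z.1 i ^ 2 ≤ phaseNormSq z ∧ z.2 i ^ 2 ≤ phaseNormSq z := by
  have h := Finset.single_le_sum (f := fun j : Fin N => z.1 j ^ 2 + z.2 j ^ 2)
    (fun j _ => by positivity) (Finset.mem_univ i)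
  unfold phaseNormSq
  constructor <;> nlinarith [sq_nonneg (z.1 i), sq_nonneg (z.2 i)]

/-- `S(z) ≤ 2N ‖z‖²` (sup norm). [folklore] -/
theorem phaseNormSq_le (z : PhaseSpace N) : phaseNormSq z ≤ 2 * N * ‖z‖ ^ 2 := by
  unfold phaseNormSq
  have h1 : ∀ i, z.1 i ^ 2 ≤ ‖z‖ ^ 2 := fun i => by
    have : |z.1 i| ≤ ‖z‖ := by
      rw [← Real.norm_eq_abs]; exact (norm_le_pi_norm z.1 i).trans (norm_fst_le z)
    rw [← sq_abs]; exact pow_le_pow_left₀ (abs_nonneg _) this 2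
  have h2 : ∀ i, z.2 i ^ 2 ≤ ‖z‖ ^ 2 := fun i => by
    have : |z.2 i| ≤ ‖z‖ := by
      rw [← Real.norm_eq_abs]; exact (norm_le_pi_norm z.2 i).trans (norm_snd_le z)
    rw [← sq_abs]; exact pow_le_pow_left₀ (abs_nonneg _) this 2
  calc ∑ i, (z.1 i ^ 2 + z.2 i ^ 2) ≤ ∑ _i : Fin N, (‖z‖ ^ 2 + ‖z‖ ^ 2) :=
        Finset.sum_le_sum fun i _ => add_le_add (h1 i) (h2 i)
    _ = 2 * N * ‖z‖ ^ 2 := by simp; ring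

/-- `‖z‖ ≤ √S(z)` (sup norm). [folklore] -/
theorem norm_le_sqrt_phaseNormSq (z : PhaseSpace N) : ‖z‖ ≤ Real.sqrt (phaseNormSq z) := by
  have h : ∀ v : Fin N → ℝ, (∀ i, v i ^ 2 ≤ phaseNormSq z) → ‖v‖ ≤ Real.sqrt (phaseNormSq z) := by
    intro v hv
    refine (pi_norm_le_iff_of_nonneg (Real.sqrt_nonneg _)).2 fun i => ?_
    rw [Real.norm_eq_abs, ← Real.sqrt_sq_eq_abs]
    exact Real.sqrt_le_sqrt (hv i)
  rw [Prod.norm_def]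
  exact max_le (h z.1 fun i => (sq_le_phaseNormSq z i).1) (h z.2 fun i => (sq_le_phaseNormSq z i).2)

/-- `‖z‖² ≤ S(z)` (sup norm). [folklore] -/
theorem norm_sq_le_phaseNormSq (z : PhaseSpace N) : ‖z‖ ^ 2 ≤ phaseNormSq z := by
  calc ‖z‖ ^ 2 ≤ Real.sqrt (phaseNormSq z) ^ 2 :=
        pow_le_pow_left₀ (norm_nonneg _) (norm_le_sqrt_phaseNormSq z) 2
    _ = phaseNormSq z := Real.sq_sqrt (phaseNormSq_nonneg z)

/-- The **smooth radial cutoff** `χ_R(z) = χ(S(z)/R²)` (`χ = smoothCutoff` of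
`LangevinChainExpBound.lean`: `= 1` where `S ≤ R²`, `= 0` where `S ≥ 2R²`, values in `[0,1]`).
[folklore] -/
def phaseCutoff (R : ℝ) (z : PhaseSpace N) : ℝ := smoothCutoff (phaseNormSq z / R ^ 2)

/-- `χ_R` is smooth. [folklore] -/
theorem contDiff_phaseCutoff (R : ℝ) {n : ℕ∞} : ContDiff ℝ n (phaseCutoff R : PhaseSpace N → ℝ) :=
  contDiff_smoothCutoff.comp (contDiff_phaseNormSq.div_const _)

/-- `χ_R = 1` where `S ≤ R²`. [folklore] -/
theorem phaseCutoff_eq_one {R : ℝ} (hR : 0 < R) {z : PhaseSpace N} (h : phaseNormSq z ≤ R ^ 2) :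
    phaseCutoff R z = 1 :=
  smoothCutoff_of_le_one ((div_le_one (by positivity)).2 h)

/-- `χ_R = 0` where `S ≥ 2R²`. [folklore] -/
theorem phaseCutoff_eq_zero {R : ℝ} (hR : 0 < R) {z : PhaseSpace N} (h : 2 * R ^ 2 ≤ phaseNormSq z) :
    phaseCutoff R z = 0 :=
  smoothCutoff_of_two_le ((le_div_iff₀ (by positivity)).2 h)

/-- `0 ≤ χ_R ≤ 1`. [folklore] -/
theorem phaseCutoff_mem_Icc (R : ℝ) (z : PhaseSpace N) : phaseCutoff R z ∈ Icc (0 : ℝ) 1 :=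
  ⟨smoothCutoff_nonneg _, smoothCutoff_le_one _⟩

/-- The **truncated limit field** `X_R = χ_R • Ŷ`: smooth, compactly supported, equal to the limit
drift `Ŷ` where `S ≤ R²`; being a scalar multiple of the Hamiltonian field it still conserves `Ĥ`
exactly. [folklore] -/
def limitChainField (lam β : ℝ) (N : ℕ) (R : ℝ) (z : PhaseSpace N) : PhaseSpace N :=
  phaseCutoff R z • (limitChain lam β).drift N z

/-- `X_R` is smooth. [folklore] -/
theorem contDiff_limitChainField (lam β : ℝ) (N : ℕ) (R : ℝ) {n : ℕ∞} :
    ContDiff ℝ n (limitChainField lam β N R) :=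
  (contDiff_phaseCutoff R).smul (limitChain_contDiff_drift lam β N)

/-- `X_R = Ŷ` where `S ≤ R²`. [folklore] -/
theorem limitChainField_eq_drift {lam β : ℝ} {R : ℝ} (hR : 0 < R) {z : PhaseSpace N}
    (h : phaseNormSq z ≤ R ^ 2) : limitChainField lam β N R z = (limitChain lam β).drift N z := by
  rw [limitChainField, phaseCutoff_eq_one hR h, one_smul]

/-- `X_R` has compact support (inside `{S ≤ 2R²}`, a closed bounded set). [folklore] -/
theorem hasCompactSupport_limitChainField (lam β : ℝ) (N : ℕ) {R : ℝ} (hR : 0 < R) :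
    HasCompactSupport (limitChainField lam β N R) := by
  refine HasCompactSupport.intro (K := {z : PhaseSpace N | phaseNormSq z ≤ 2 * R ^ 2}) ?_ ?_
  · have hclosed : IsClosed {z : PhaseSpace N | phaseNormSq z ≤ 2 * R ^ 2} :=
      isClosed_le (contDiff_phaseNormSq (n := 0)).continuous continuous_const
    refine (isCompact_closedBall (0 : PhaseSpace N) (Real.sqrt 2 * R)).of_isClosed_subset hclosed ?_
    intro z hz
    rw [mem_setOf_eq] at hz
    rw [mem_closedBall, dist_zero_right]
    have h1 : ‖z‖ ^ 2 ≤ (Real.sqrt 2 * R) ^ 2 := by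
      rw [mul_pow, Real.sq_sqrt (by norm_num)]
      exact (norm_sq_le_phaseNormSq z).trans hz
    exact (pow_le_pow_iff_left₀ (norm_nonneg z) (by positivity) two_ne_zero).1 h1
  · intro z hz
    rw [mem_setOf_eq, not_le] at hz
    rw [limitChainField, phaseCutoff_eq_zero hR hz.le, zero_smul]

/-! ### The flow of the truncated limit field -/

/-- `X_R` is globally Lipschitz (`C¹` with compact support). [folklore] -/
theorem exists_lipschitzWith_limitChainField (lam β : ℝ) (N : ℕ) {R : ℝ} (hR : 0 < R) :
    ∃ C, LipschitzWith C (limitChainField lam β N R) :=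
  (contDiff_limitChainField lam β N R (n := 1)).lipschitzWith_of_hasCompactSupport
    (hasCompactSupport_limitChainField lam β N hR) one_ne_zero

/-- A Lipschitz constant of `X_R` (chosen). [folklore] -/
theorem lipschitzWith_limitChainField (lam β : ℝ) (N : ℕ) {R : ℝ} (hR : 0 < R) :
    LipschitzWith (exists_lipschitzWith_limitChainField lam β N hR).choose (limitChainField lam β N R) :=
  (exists_lipschitzWith_limitChainField lam β N hR).choose_spec

/-- The **flow of the truncated limit field** `Ψ_R x̂ σ` (global, smooth jointly in `(x̂, σ)`;
`Literature.Analysis.ODE.lipschitzFlow`). On trajectories staying in `{S ≤ R²}` it is the flow of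
the limit Hamiltonian system `dq̂ = p̂ dσ`, `dp̂ = -∇Φ̂(q̂) dσ` of CEHR (5.10).
[cite: CuneoEckmannHairerReyBellet2018, §5.1 eq. (5.10)] -/
def limitChainFlow (lam β : ℝ) (N : ℕ) {R : ℝ} (hR : 0 < R) : PhaseSpace N → ℝ → PhaseSpace N :=
  lipschitzFlow (lipschitzWith_limitChainField lam β N hR)

section Flow

variable (lam β : ℝ) (N : ℕ) {R : ℝ} (hR : 0 < R)

/-- `Ψ x̂ 0 = x̂`. [folklore] -/
@[simp] theorem limitChainFlow_zero (x : PhaseSpace N) : limitChainFlow lam β N hR x 0 = x :=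
  lipschitzFlow_zero _ x

/-- `Ψ x̂` is an integral curve of `X_R`. [folklore] -/
theorem hasDerivAt_limitChainFlow (x : PhaseSpace N) (t : ℝ) :
    HasDerivAt (limitChainFlow lam β N hR x) (limitChainField lam β N R (limitChainFlow lam β N hR x t)) t :=
  hasDerivAt_lipschitzFlow _ x t

/-- `Ψ` is continuous jointly in `(x̂, σ)`. [folklore] -/
theorem continuous_limitChainFlow : Continuous fun p : PhaseSpace N × ℝ => limitChainFlow lam β N hR p.1 p.2 :=
  (contDiff_lipschitzFlow (contDiff_limitChainField lam β N R (n := 1)) le_rfl _).continuous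

/-- `Ψ x̂` is continuous in time. [folklore] -/
theorem continuous_limitChainFlow_right (x : PhaseSpace N) : Continuous (limitChainFlow lam β N hR x) :=
  (continuous_limitChainFlow lam β N hR).comp (Continuous.prodMk_right x)

/-- `Ψ · σ` is continuous in the initial condition. [folklore] -/
theorem continuous_limitChainFlow_left (t : ℝ) : Continuous fun x => limitChainFlow lam β N hR x t :=
  (continuous_limitChainFlow lam β N hR).comp (Continuous.prodMk_left t)

/-- **Energy conservation**: `Ĥ(Ψ x̂ σ) = Ĥ(x̂)` (`X_R = χ_R Ŷ` and `DĤ·Ŷ = 0`). [folklore] -/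
theorem limitChain_hamiltonian_limitChainFlow (x : PhaseSpace N) (t : ℝ) :
    (limitChain lam β).hamiltonian N (limitChainFlow lam β N hR x t) = (limitChain lam β).hamiltonian N x := by
  set H := (limitChain lam β).hamiltonian N with hH
  have hHd : Differentiable ℝ H :=
    (limitChain_contDiff_hamiltonian lam β N (n := 1)).differentiable one_ne_zero
  have hd : ∀ s, HasDerivAt (fun s => H (limitChainFlow lam β N hR x s)) 0 s := fun s => by
    have h1 := (hHd (limitChainFlow lam β N hR x s)).hasFDerivAt.comp_hasDerivAt s
      (hasDerivAt_limitChainFlow lam β N hR x s)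
    have h2 : fderiv ℝ H (limitChainFlow lam β N hR x s) (limitChainField lam β N R (limitChainFlow lam β N hR x s)) = 0 := by
      rw [limitChainField, map_smul, hH, limitChain_fderiv_hamiltonian_drift, smul_zero]
    rw [h2] at h1
    exact h1
  have := is_const_of_deriv_eq_zero (f := fun s => H (limitChainFlow lam β N hR x s))
    (fun s => (hd s).differentiableAt) (fun s => (hd s).deriv) t 0
  simpa using this

variable {lam β}

/-- Momenta along the flow are bounded by the (conserved) energy: `|p̂_i(σ)| ≤ Ĥ(x̂) + 1/2`
(`lam, β ≥ 0`). [folklore] -/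
theorem abs_limitChainFlow_snd_le (hl : 0 ≤ lam) (hβ : 0 ≤ β) (x : PhaseSpace N) (t : ℝ) (i : Fin N) :
    |(limitChainFlow lam β N hR x t).2 i| ≤ (limitChain lam β).hamiltonian N x + 1 / 2 := by
  have h := limitChain_abs_momentum_le hl hβ N (limitChainFlow lam β N hR x t) i
  rwa [limitChain_hamiltonian_limitChainFlow] at h

/-- The position components of `Ψ x̂` have derivative `χ_R p̂_i`. [folklore] -/
theorem hasDerivAt_limitChainFlow_fst (x : PhaseSpace N) (t : ℝ) (i : Fin N) :
    HasDerivAt (fun s => (limitChainFlow lam β N hR x s).1 i)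
      (phaseCutoff R (limitChainFlow lam β N hR x t) * (limitChainFlow lam β N hR x t).2 i) t := by
  have h := hasDerivAt_limitChainFlow lam β N hR x t
  have h1 : HasDerivAt (fun s => (limitChainFlow lam β N hR x s).1)
      (limitChainField lam β N R (limitChainFlow lam β N hR x t)).1 t :=
    (ContinuousLinearMap.fst ℝ (Fin N → ℝ) (Fin N → ℝ)).hasFDerivAt.comp_hasDerivAt t h
  have h2 := (hasDerivAt_pi.1 h1) i
  simpa [limitChainField, OscillatorChain.drift] using h2

/-- The momentum components of `Ψ x̂` have derivative `-χ_R ∂_{q_i}Ĥ`. [folklore] -/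
theorem hasDerivAt_limitChainFlow_snd (x : PhaseSpace N) (t : ℝ) (i : Fin N) :
    HasDerivAt (fun s => (limitChainFlow lam β N hR x s).2 i)
      (phaseCutoff R (limitChainFlow lam β N hR x t) *
        -partialQ i ((limitChain lam β).hamiltonian N) (limitChainFlow lam β N hR x t)) t := by
  have h := hasDerivAt_limitChainFlow lam β N hR x t
  have h1 : HasDerivAt (fun s => (limitChainFlow lam β N hR x s).2)
      (limitChainField lam β N R (limitChainFlow lam β N hR x t)).2 t :=
    (ContinuousLinearMap.snd ℝ (Fin N → ℝ) (Fin N → ℝ)).hasFDerivAt.comp_hasDerivAt t h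
  have h2 := (hasDerivAt_pi.1 h1) i
  have hγ : (limitChain lam β).γ = 0 := rfl
  simpa [limitChainField, OscillatorChain.drift, hγ] using h2

/-- **Positions move at bounded speed**: `|q̂_i(σ) - q̂_i(0)| ≤ (Ĥ(x̂) + 1/2) σ` for `σ ≥ 0`.
[folklore] -/
theorem abs_limitChainFlow_fst_sub_le (hl : 0 ≤ lam) (hβ : 0 ≤ β) (x : PhaseSpace N) {t : ℝ}
    (ht : 0 ≤ t) (i : Fin N) :
    |(limitChainFlow lam β N hR x t).1 i - x.1 i| ≤ ((limitChain lam β).hamiltonian N x + 1 / 2) * t := by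
  have hb : ∀ s ∈ Ico (0 : ℝ) t, ‖phaseCutoff R (limitChainFlow lam β N hR x s) *
      (limitChainFlow lam β N hR x s).2 i‖ ≤ (limitChain lam β).hamiltonian N x + 1 / 2 := by
    intro s _
    rw [Real.norm_eq_abs, abs_mul]
    have hχ := phaseCutoff_mem_Icc R (limitChainFlow lam β N hR x s)
    calc |phaseCutoff R (limitChainFlow lam β N hR x s)| * |(limitChainFlow lam β N hR x s).2 i|
        ≤ 1 * ((limitChain lam β).hamiltonian N x + 1 / 2) := by
          refine mul_le_mul ?_ (abs_limitChainFlow_snd_le N hR hl hβ x s i) (abs_nonneg _) zero_le_one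
          rw [abs_of_nonneg hχ.1]; exact hχ.2
      _ = _ := one_mul _
  have h := norm_image_sub_le_of_norm_deriv_le_segment' (f := fun s => (limitChainFlow lam β N hR x s).1 i)
    (fun s _ => (hasDerivAt_limitChainFlow_fst N hR x s i).hasDerivWithinAt) hb t ⟨ht, le_rfl⟩
  simpa [Real.norm_eq_abs] using h

/-- **Confinement**: if `Ĥ(x̂) ≤ h₀`, `|x̂.q_i| ≤ ρ` for all `i`, and
`N((ρ + (h₀+1/2)Λ)² + (h₀+1/2)²) ≤ R²`, then `S(Ψ x̂ σ) ≤ R²` for `σ ∈ [0, Λ]` — the truncation is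
invisible on `[0, Λ]`. [folklore] -/
theorem phaseNormSq_limitChainFlow_le (hl : 0 ≤ lam) (hβ : 0 ≤ β) {h₀ ρ Λ : ℝ}
    (hRad : N * ((ρ + (h₀ + 1 / 2) * Λ) ^ 2 + (h₀ + 1 / 2) ^ 2) ≤ R ^ 2)
    {x : PhaseSpace N} (hx : (limitChain lam β).hamiltonian N x ≤ h₀) (hρ : ∀ i, |x.1 i| ≤ ρ)
    {t : ℝ} (ht : t ∈ Icc 0 Λ) : phaseNormSq (limitChainFlow lam β N hR x t) ≤ R ^ 2 := by
  have hH0 : 0 ≤ (limitChain lam β).hamiltonian N x :=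
    le_trans (Finset.sum_nonneg fun i _ => by positivity) (limitChain_kinetic_le_hamiltonian hl hβ N x)
  have hq : ∀ i, (limitChainFlow lam β N hR x t).1 i ^ 2 ≤ (ρ + (h₀ + 1 / 2) * Λ) ^ 2 := fun i => by
    have h1 := abs_limitChainFlow_fst_sub_le N hR hl hβ x ht.1 i
    have h2 : |(limitChainFlow lam β N hR x t).1 i| ≤ ρ + (h₀ + 1 / 2) * Λ := by
      calc |(limitChainFlow lam β N hR x t).1 i|
          ≤ |(limitChainFlow lam β N hR x t).1 i - x.1 i| + |x.1 i| := by
            have := abs_add_le ((limitChainFlow lam β N hR x t).1 i - x.1 i) (x.1 i)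
            rwa [sub_add_cancel] at this
        _ ≤ ((limitChain lam β).hamiltonian N x + 1 / 2) * t + ρ := add_le_add h1 (hρ i)
        _ ≤ (h₀ + 1 / 2) * Λ + ρ := by
            have : ((limitChain lam β).hamiltonian N x + 1 / 2) * t ≤ (h₀ + 1 / 2) * Λ :=
              mul_le_mul (by linarith) ht.2 ht.1 (by linarith)
            linarith
        _ = ρ + (h₀ + 1 / 2) * Λ := add_comm _ _
    rw [← sq_abs]
    exact pow_le_pow_left₀ (abs_nonneg _) h2 2
  have hp : ∀ i, (limitChainFlow lam β N hR x t).2 i ^ 2 ≤ (h₀ + 1 / 2) ^ 2 := fun i => by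
    have h1 := abs_limitChainFlow_snd_le N hR hl hβ x t i
    rw [← sq_abs]
    exact pow_le_pow_left₀ (abs_nonneg _) (h1.trans (by linarith)) 2
  calc phaseNormSq (limitChainFlow lam β N hR x t)
      = ∑ i, ((limitChainFlow lam β N hR x t).1 i ^ 2 + (limitChainFlow lam β N hR x t).2 i ^ 2) := rfl
    _ ≤ ∑ _i : Fin N, ((ρ + (h₀ + 1 / 2) * Λ) ^ 2 + (h₀ + 1 / 2) ^ 2) :=
        Finset.sum_le_sum fun i _ => add_le_add (hq i) (hp i)
    _ = N * ((ρ + (h₀ + 1 / 2) * Λ) ^ 2 + (h₀ + 1 / 2) ^ 2) := by simp [mul_add]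
    _ ≤ R ^ 2 := hRad

/-- **On `[0, Λ]` the truncated flow solves the limit Hamiltonian system** `ẑ' = Ŷ(ẑ)` (under
the confinement hypotheses of `phaseNormSq_limitChainFlow_le`). [cite: CuneoEckmannHairerReyBellet2018, §5.1 eq. (5.10)] -/
theorem hasDerivAt_limitChainFlow_drift (hl : 0 ≤ lam) (hβ : 0 ≤ β) {h₀ ρ Λ : ℝ}
    (hRad : N * ((ρ + (h₀ + 1 / 2) * Λ) ^ 2 + (h₀ + 1 / 2) ^ 2) ≤ R ^ 2)
    {x : PhaseSpace N} (hx : (limitChain lam β).hamiltonian N x ≤ h₀) (hρ : ∀ i, |x.1 i| ≤ ρ)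
    {t : ℝ} (ht : t ∈ Icc 0 Λ) :
    HasDerivAt (limitChainFlow lam β N hR x) ((limitChain lam β).drift N (limitChainFlow lam β N hR x t)) t := by
  have h := hasDerivAt_limitChainFlow lam β N hR x t
  rwa [limitChainField_eq_drift hR (phaseNormSq_limitChainFlow_le N hR hl hβ hRad hx hρ ht)] at h

/-- **The integral equation of the limit system**: `Ψ x̂ σ = x̂ + ∫₀^σ Ŷ(Ψ x̂ s) ds` for
`σ ∈ [0, Λ]` (under the confinement hypotheses). [cite: CuneoEckmannHairerReyBellet2018, §5.1 eq. (5.10)] -/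
theorem limitChainFlow_eq_add_integral (hl : 0 ≤ lam) (hβ : 0 ≤ β) {h₀ ρ Λ : ℝ}
    (hRad : N * ((ρ + (h₀ + 1 / 2) * Λ) ^ 2 + (h₀ + 1 / 2) ^ 2) ≤ R ^ 2)
    {x : PhaseSpace N} (hx : (limitChain lam β).hamiltonian N x ≤ h₀) (hρ : ∀ i, |x.1 i| ≤ ρ)
    {t : ℝ} (ht : t ∈ Icc 0 Λ) :
    limitChainFlow lam β N hR x t =
      x + ∫ s in (0 : ℝ)..t, (limitChain lam β).drift N (limitChainFlow lam β N hR x s) := by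
  have hc : Continuous fun s => limitChainField lam β N R (limitChainFlow lam β N hR x s) :=
    (contDiff_limitChainField lam β N R (n := 0)).continuous.comp (continuous_limitChainFlow_right lam β N hR x)
  have hFTC := intervalIntegral.integral_eq_sub_of_hasDerivAt
    (fun s _ => hasDerivAt_limitChainFlow lam β N hR x s) (hc.intervalIntegrable 0 t)
  rw [limitChainFlow_zero] at hFTC
  have hcongr : ∫ s in (0 : ℝ)..t, limitChainField lam β N R (limitChainFlow lam β N hR x s) =
      ∫ s in (0 : ℝ)..t, (limitChain lam β).drift N (limitChainFlow lam β N hR x s) :=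
    intervalIntegral.integral_congr fun s hs => by
      have hs' : s ∈ Icc 0 Λ := by
        rw [uIcc_of_le ht.1] at hs
        exact ⟨hs.1, hs.2.trans ht.2⟩
      exact limitChainField_eq_drift hR (phaseNormSq_limitChainFlow_le N hR hl hβ hRad hx hρ hs')
  rw [← hcongr, hFTC]
  abel

end Flow

/-! ### Closed form of the force, and the Euler identity of the limit potential -/

/-- The force of the limit chain: `∂Φ̂/∂q_i = lam q_i³ + [1 ≤ i] β(q_i - q_{i-1})³
- [i+1 < N] β(q_{i+1} - q_i)³`. [cite: CuneoEckmannHairerReyBellet2018, §5.1 eq. (5.10)] -/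
theorem limitChain_dPotential_eq (lam β : ℝ) (N : ℕ) (i : Fin N) (q : Fin N → ℝ) :
    (limitChain lam β).dPotential N i q = lam * q i ^ 3 +
      (if h : 0 < i.val then β * (q i - q ⟨i.val - 1, by omega⟩) ^ 3 else 0) -
        (if h : i.val + 1 < N then β * (q ⟨i.val + 1, h⟩ - q i) ^ 3 else 0) := by
  rw [(limitChain lam β).dPotential_eq_closed N i q, limitChain_deriv_U]
  simp only [limitChain_deriv_V]

/-- **Euler's identity for the (degree-4 homogeneous) limit potential**:
`∑_k q_k ∂Φ̂/∂q_k = 4 Φ̂(q)`. [folklore] -/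
theorem limitChain_sum_mul_dPotential (lam β : ℝ) (N : ℕ) (q : Fin N → ℝ) :
    ∑ k, q k * (limitChain lam β).dPotential N k q = 4 * (limitChain lam β).potential N q := by
  simp only [OscillatorChain.dPotential, OscillatorChain.potential, limitChain_deriv_U, limitChain_deriv_V,
    mul_add, Finset.sum_add_distrib]
  congr 1
  · simp only [limitChain, Finset.mul_sum]
    exact Finset.sum_congr rfl fun k _ => by ring
  · -- the interaction part
    have h1 : ∀ k : Fin N, q k * ∑ k' : Fin N, ∑ l : Fin N, (if l.val = k'.val + 1 then
        β * (q l - q k') ^ 3 * ((if l = k then 1 else 0) - (if k' = k then 1 else 0)) else 0) =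
        ∑ k' : Fin N, ∑ l : Fin N, (if l.val = k'.val + 1 then
          β * (q l - q k') ^ 3 * (q k * ((if l = k then 1 else 0) - (if k' = k then 1 else 0))) else 0) := by
      intro k
      rw [Finset.mul_sum]
      refine Finset.sum_congr rfl fun k' _ => ?_
      rw [Finset.mul_sum]
      refine Finset.sum_congr rfl fun l _ => ?_
      split_ifs <;> ring
    simp_rw [h1]
    rw [Finset.sum_comm]
    simp only [limitChain, Finset.mul_sum]
    refine Finset.sum_congr rfl fun k' _ => ?_
    rw [Finset.sum_comm]
    refine Finset.sum_congr rfl fun l _ => ?_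
    by_cases h : l.val = k'.val + 1
    · simp only [h, if_true]
      have h2 : ∑ k : Fin N, β * (q l - q k') ^ 3 * (q k * ((if l = k then 1 else 0) - (if k' = k then 1 else 0))) =
          β * (q l - q k') ^ 3 * (q l - q k') := by
        rw [← Finset.mul_sum]
        congr 1
        simp only [mul_sub, Finset.sum_sub_distrib, mul_ite, mul_one, mul_zero]
        rw [Finset.sum_ite_eq Finset.univ l, Finset.sum_ite_eq Finset.univ k']
        simp
      rw [h2]
      ring
    · simp [h]

/-! ### Unique continuation: a bath site at rest on a time interval forces zero energy -/

section UniqueContinuation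

/-- A function constant on `[0, Λ]` (`Λ > 0`) has zero derivative there (one-sided uniqueness of
derivatives on an interval). [folklore] -/
theorem deriv_eq_zero_of_eqOn_Icc {f f' : ℝ → ℝ} {Λ c : ℝ} (hΛ : 0 < Λ)
    (hf : ∀ σ ∈ Icc 0 Λ, HasDerivAt f (f' σ) σ) (hc : ∀ σ ∈ Icc 0 Λ, f σ = c) :
    ∀ σ ∈ Icc 0 Λ, f' σ = 0 := by
  intro σ hσ
  have h1 : HasDerivWithinAt f (f' σ) (Icc 0 Λ) σ := (hf σ hσ).hasDerivWithinAt
  have h2 : HasDerivWithinAt f 0 (Icc 0 Λ) σ :=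
    (hasDerivWithinAt_const σ (Icc 0 Λ) c).congr (fun s hs => hc s hs) (hc σ hσ)
  exact (uniqueDiffOn_Icc hΛ σ hσ).eq_deriv _ h1 h2

/-- A function with zero derivative on `[0, Λ]` is constant there. [folklore] -/
theorem eq_of_hasDerivAt_zero_Icc {f : ℝ → ℝ} {Λ : ℝ}
    (hf : ∀ σ ∈ Icc 0 Λ, HasDerivAt f 0 σ) : ∀ σ ∈ Icc 0 Λ, f σ = f 0 :=
  constant_of_has_deriv_right_zero (fun σ hσ => (hf σ hσ).continuousAt.continuousWithinAt)
    (fun σ hσ => (hf σ ⟨hσ.1, hσ.2.le⟩).hasDerivWithinAt)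

variable {lam β : ℝ}

/-- **Unique continuation for the limit chain** (the qualitative heart of CEHR Prop. 5.14:
"assume `p̂_b(σ) ≡ 0` on `[0, λ]` … since the total force on `b` is identically zero, we must have
that `∇V_∞(q̂_b - q̂_v)` is constant … by C4 `q̂_b - q̂_v` is constant … proceeding inductively no
mass moves … which is only possible if `Ĥ(ẑ₀) = 0`"): if a solution of the limit Hamiltonian
system (`β > 0`, `lam ≥ 0`, a chain with `N ≥ 1` sites) has its left bath momentum `p̂_0 ≡ 0` on
`[0, Λ]`, `Λ > 0`, then its energy vanishes. The induction runs along the chain: `p̂_k ≡ 0` ⇒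
`q̂_k` constant and `∂_kΦ̂(q̂) ≡ 0` ⇒ `β(q̂_{k+1} - q̂_k)³` constant ⇒ (cubes are injective)
`q̂_{k+1}` constant ⇒ `p̂_{k+1} ≡ 0`; at the end all masses rest at a critical point of the
degree-4 homogeneous `Φ̂`, where `Φ̂ = ¼ ∑ q_k ∂_kΦ̂ = 0` (Euler).
[cite: CuneoEckmannHairerReyBellet2018, Prop 5.14 and Rem 5.15] -/
theorem limitChain_hamiltonian_eq_zero_of_resting (hβ : 0 < β) (hN : 0 < N)
    {Λ : ℝ} (hΛ : 0 < Λ) {z : ℝ → PhaseSpace N}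
    (hz : ∀ σ ∈ Icc 0 Λ, HasDerivAt z ((limitChain lam β).drift N (z σ)) σ)
    (hp0 : ∀ σ ∈ Icc 0 Λ, (z σ).2 ⟨0, hN⟩ = 0) :
    (limitChain lam β).hamiltonian N (z 0) = 0 := by
  have hUd : Differentiable ℝ (limitChain lam β).U :=
    (limitChain_contDiff_U lam β (n := 1)).differentiable one_ne_zero
  have hVd : Differentiable ℝ (limitChain lam β).V :=
    (limitChain_contDiff_V lam β (n := 1)).differentiable one_ne_zero
  have h0 : (0 : ℝ) ∈ Icc 0 Λ := ⟨le_rfl, hΛ.le⟩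
  -- component derivatives
  have hq' : ∀ i, ∀ σ ∈ Icc 0 Λ, HasDerivAt (fun s => (z s).1 i) ((z σ).2 i) σ := by
    intro i σ hσ
    have h1 := (ContinuousLinearMap.fst ℝ (Fin N → ℝ) (Fin N → ℝ)).hasFDerivAt.comp_hasDerivAt σ
      (hz σ hσ)
    have h2 := (hasDerivAt_pi.1 h1) i
    simpa [OscillatorChain.drift] using h2
  have hp' : ∀ i, ∀ σ ∈ Icc 0 Λ,
      HasDerivAt (fun s => (z s).2 i) (-((limitChain lam β).dPotential N i (z σ).1)) σ := by
    intro i σ hσ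
    have h1 := (ContinuousLinearMap.snd ℝ (Fin N → ℝ) (Fin N → ℝ)).hasFDerivAt.comp_hasDerivAt σ
      (hz σ hσ)
    have h2 := (hasDerivAt_pi.1 h1) i
    have hγ : (limitChain lam β).γ = 0 := rfl
    simpa [OscillatorChain.drift, hγ,
      (limitChain lam β).partialQ_hamiltonian_eq_dPotential hUd hVd] using h2
  -- from `p̂_i ≡ 0`: `q̂_i` is constant and `∂_iΦ̂ ∘ q̂ ≡ 0`
  have hconst : ∀ i, (∀ σ ∈ Icc 0 Λ, (z σ).2 i = 0) →
      ∀ σ ∈ Icc 0 Λ, (z σ).1 i = (z 0).1 i := by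
    intro i hi
    exact eq_of_hasDerivAt_zero_Icc fun σ hσ => by simpa [hi σ hσ] using hq' i σ hσ
  have hforce : ∀ i, (∀ σ ∈ Icc 0 Λ, (z σ).2 i = 0) →
      ∀ σ ∈ Icc 0 Λ, (limitChain lam β).dPotential N i (z σ).1 = 0 := by
    intro i hi σ hσ
    have := deriv_eq_zero_of_eqOn_Icc hΛ (hp' i) (c := 0) hi σ hσ
    linarith
  have hinj : Function.Injective fun x : ℝ => x ^ 3 :=
    (Odd.strictMono_pow (⟨1, by norm_num⟩ : Odd 3)).injective
  -- induction along the chain: all momenta vanish identically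
  have hall : ∀ k : ℕ, ∀ j ≤ k, ∀ (hj : j < N), ∀ σ ∈ Icc 0 Λ, (z σ).2 ⟨j, hj⟩ = 0 := by
    intro k
    induction k with
    | zero =>
      intro j hj hjN σ hσ
      obtain rfl : j = 0 := Nat.le_zero.1 hj
      exact hp0 σ hσ
    | succ k ih =>
      intro j hj hjN σ hσ
      rcases Nat.lt_or_ge j (k + 1) with hjk | hjk
      · exact ih j (Nat.lt_succ_iff.1 hjk) hjN σ hσ
      · obtain rfl : j = k + 1 := le_antisymm hj hjk
        have hkN : k < N := by omega
        have hpk : ∀ σ ∈ Icc 0 Λ, (z σ).2 ⟨k, hkN⟩ = 0 := ih k le_rfl hkN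
        have hqk : ∀ σ ∈ Icc 0 Λ, (z σ).1 ⟨k, hkN⟩ = (z 0).1 ⟨k, hkN⟩ := hconst _ hpk
        have hFk : ∀ σ ∈ Icc 0 Λ, (limitChain lam β).dPotential N ⟨k, hkN⟩ (z σ).1 = 0 := hforce _ hpk
        -- the bond `(k, k+1)`: `(q̂_{k+1}(σ) - a_k)³` is constant in `σ`
        have hcube : ∀ σ ∈ Icc 0 Λ, ((z σ).1 ⟨k + 1, hjN⟩ - (z 0).1 ⟨k, hkN⟩) ^ 3 =
            ((z 0).1 ⟨k + 1, hjN⟩ - (z 0).1 ⟨k, hkN⟩) ^ 3 := by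
          intro σ hσ
          have e1 := hFk σ hσ
          have e0 := hFk 0 h0
          rw [limitChain_dPotential_eq] at e1 e0
          simp only [dif_pos hjN] at e1 e0
          by_cases hk0 : 0 < k
          · simp only [dif_pos hk0] at e1 e0
            have hpk1 : ∀ σ ∈ Icc 0 Λ, (z σ).2 ⟨k - 1, by omega⟩ = 0 :=
              ih (k - 1) (by omega) (by omega)
            have hqk1 := hconst _ hpk1 σ hσ
            rw [hqk σ hσ, hqk1] at e1
            have : β * ((z σ).1 ⟨k + 1, hjN⟩ - (z 0).1 ⟨k, hkN⟩) ^ 3 =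
                β * ((z 0).1 ⟨k + 1, hjN⟩ - (z 0).1 ⟨k, hkN⟩) ^ 3 := by linarith
            exact mul_left_cancel₀ hβ.ne' this
          · simp only [dif_neg hk0] at e1 e0
            rw [hqk σ hσ] at e1
            have : β * ((z σ).1 ⟨k + 1, hjN⟩ - (z 0).1 ⟨k, hkN⟩) ^ 3 =
                β * ((z 0).1 ⟨k + 1, hjN⟩ - (z 0).1 ⟨k, hkN⟩) ^ 3 := by linarith
            exact mul_left_cancel₀ hβ.ne' this
        have hqk1c : ∀ σ ∈ Icc 0 Λ, (z σ).1 ⟨k + 1, hjN⟩ = (z 0).1 ⟨k + 1, hjN⟩ := by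
          intro σ hσ
          have := hinj (hcube σ hσ)
          linarith
        exact deriv_eq_zero_of_eqOn_Icc hΛ (hq' ⟨k + 1, hjN⟩) hqk1c σ hσ
  have hpall : ∀ i : Fin N, ∀ σ ∈ Icc 0 Λ, (z σ).2 i = 0 := fun i =>
    hall i.val i.val le_rfl i.isLt
  -- at time `0`: no kinetic energy, and a critical point of the homogeneous potential
  have hkin : ∑ i, (z 0).2 i ^ 2 / 2 = 0 :=
    Finset.sum_eq_zero fun i _ => by rw [hpall i 0 h0]; norm_num
  have hcrit : ∀ i, (limitChain lam β).dPotential N i (z 0).1 = 0 := fun i => hforce i (hpall i) 0 h0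
  have hpot : (limitChain lam β).potential N (z 0).1 = 0 := by
    have h := limitChain_sum_mul_dPotential lam β N (z 0).1
    rw [Finset.sum_eq_zero (fun i _ => by rw [hcrit i, mul_zero])] at h
    linarith
  rw [(limitChain lam β).hamiltonian_eq_kinetic_add_potential, hkin, hpot, add_zero]

end UniqueContinuation

/-! ### The dissipation functional of the limit flow: continuity, positivity, uniform lower bound -/

section Dissipation

variable (lam β : ℝ) (N : ℕ) {R : ℝ} (hR : 0 < R)

/-- The **dissipation functional** `F(x̂) = ∫₀^Λ ∑_i w_i p̂_i(σ)² dσ` of the limit flow started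
at `x̂` (`w_i = [i=0] + [i=N-1]` the bath weights; CEHR (5.11): `∫₀^λ ∑_b γ_b p̂_b²(σ) dσ`).
[cite: CuneoEckmannHairerReyBellet2018, Prop 5.14 eq. (5.11)] -/
def limitDissipation (Λ : ℝ) (x : PhaseSpace N) : ℝ :=
  ∫ σ in (0 : ℝ)..Λ, ∑ i, bathWeight N i * (limitChainFlow lam β N hR x σ).2 i ^ 2

/-- The integrand of `F` is continuous jointly in `(x̂, σ)`. [folklore] -/
theorem continuous_limitDissipation_integrand :
    Continuous fun p : PhaseSpace N × ℝ =>
      ∑ i, bathWeight N i * (limitChainFlow lam β N hR p.1 p.2).2 i ^ 2 := by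
  have hc := continuous_limitChainFlow lam β N hR
  exact continuous_finsetSum _ fun i _ =>
    continuous_const.mul (((continuous_apply i).comp (continuous_snd.comp hc)).pow 2)

/-- `F` is continuous (a parametric integral of a jointly continuous integrand). [folklore] -/
theorem continuous_limitDissipation (Λ : ℝ) : Continuous (limitDissipation lam β N hR Λ) := by
  unfold limitDissipation
  exact intervalIntegral.continuous_parametric_intervalIntegral_of_continuous'
    (continuous_limitDissipation_integrand lam β N hR) 0 Λ

variable {lam β}

/-- **Positivity of the dissipation** (CEHR Prop. 5.14, first step: "`∫₀^λ ∑ γ_b p̂_b² dσ > 0`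
if `Ĥ(ẑ₀) > 0`"): under the confinement hypotheses, `F(x̂) > 0` whenever `Ĥ(x̂) > 0`
(`β > 0`, `N ≥ 1`, `Λ > 0`): otherwise `p̂_0 ≡ 0` on `[0, Λ]` and the unique continuation lemma
forces `Ĥ(x̂) = 0`. [cite: CuneoEckmannHairerReyBellet2018, Prop 5.14] -/
theorem limitDissipation_pos (hl : 0 ≤ lam) (hβ : 0 < β) (hN : 0 < N) {Λ : ℝ} (hΛ : 0 < Λ)
    {h₀ ρ : ℝ} (hRad : N * ((ρ + (h₀ + 1 / 2) * Λ) ^ 2 + (h₀ + 1 / 2) ^ 2) ≤ R ^ 2)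
    {x : PhaseSpace N} (hx : (limitChain lam β).hamiltonian N x ≤ h₀) (hρ : ∀ i, |x.1 i| ≤ ρ)
    (hpos : 0 < (limitChain lam β).hamiltonian N x) :
    0 < limitDissipation lam β N hR Λ x := by
  set g : ℝ → ℝ := fun σ => ∑ i, bathWeight N i * (limitChainFlow lam β N hR x σ).2 i ^ 2 with hg
  have hw0 : ∀ i, 0 ≤ bathWeight N i := fun i => by unfold bathWeight; split_ifs <;> norm_num
  have hgc : Continuous g :=
    (continuous_limitDissipation_integrand lam β N hR).comp (Continuous.prodMk_right x)
  have hg0 : ∀ σ, 0 ≤ g σ := fun σ =>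
    Finset.sum_nonneg fun i _ => mul_nonneg (hw0 i) (sq_nonneg _)
  by_contra hle
  push Not at hle
  -- the integrand vanishes identically on `[0, Λ]`
  have hzero : ∀ σ ∈ Icc 0 Λ, g σ = 0 := by
    by_contra hne
    push Not at hne
    obtain ⟨σ₀, hσ₀, hne⟩ := hne
    have hlt : 0 < g σ₀ := lt_of_le_of_ne (hg0 σ₀) (Ne.symm hne)
    have h := intervalIntegral.integral_lt_integral_of_continuousOn_of_le_of_exists_lt hΛ
      continuousOn_const hgc.continuousOn (fun σ _ => hg0 σ) ⟨σ₀, hσ₀, hlt⟩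
    simp only [intervalIntegral.integral_zero] at h
    exact absurd (h.trans_le hle) (lt_irrefl _)
  -- hence the left bath momentum vanishes on `[0, Λ]`
  have hp0 : ∀ σ ∈ Icc 0 Λ, (limitChainFlow lam β N hR x σ).2 ⟨0, hN⟩ = 0 := by
    intro σ hσ
    have h := hzero σ hσ
    have hw : 1 ≤ bathWeight N ⟨0, hN⟩ := by
      unfold bathWeight
      simp only [if_true]
      split_ifs <;> norm_num
    have hterm : bathWeight N ⟨0, hN⟩ * (limitChainFlow lam β N hR x σ).2 ⟨0, hN⟩ ^ 2 ≤ g σ :=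
      Finset.single_le_sum (f := fun i => bathWeight N i * (limitChainFlow lam β N hR x σ).2 i ^ 2)
        (fun i _ => mul_nonneg (hw0 i) (sq_nonneg _)) (Finset.mem_univ _)
    rw [h] at hterm
    have hsq : (limitChainFlow lam β N hR x σ).2 ⟨0, hN⟩ ^ 2 ≤ 0 := by
      nlinarith [sq_nonneg ((limitChainFlow lam β N hR x σ).2 ⟨0, hN⟩)]
    exact pow_eq_zero_iff two_ne_zero |>.1 (le_antisymm hsq (sq_nonneg _))
  have hH := limitChain_hamiltonian_eq_zero_of_resting hβ hN hΛ
    (fun σ hσ => hasDerivAt_limitChainFlow_drift N hR hl hβ.le hRad hx hρ hσ) hp0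
  rw [limitChainFlow_zero] at hH
  exact absurd hH hpos.ne'

/-- **The uniform dissipation bound** (CEHR Prop. 5.14: "there is a constant `C > 0` such that
for every initial condition `ẑ₀` with `Ĥ(ẑ₀) ∈ [1/4, 2]` the solution of (5.10) satisfies
`∫₀^λ ∑ γ_b p̂_b²(σ) dσ ≥ C`", by lower semicontinuity and compactness): on the compact shell
`{h₁ ≤ Ĥ ≤ h₀, |q̂_i| ≤ ρ}` (`h₁ > 0`) the dissipation functional is bounded below by some
`ε > 0`. [cite: CuneoEckmannHairerReyBellet2018, Prop 5.14] -/
theorem exists_le_limitDissipation (hl : 0 ≤ lam) (hβ : 0 < β) (hN : 0 < N) {Λ : ℝ} (hΛ : 0 < Λ)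
    {h₀ h₁ ρ : ℝ} (hh₁ : 0 < h₁)
    (hRad : N * ((ρ + (h₀ + 1 / 2) * Λ) ^ 2 + (h₀ + 1 / 2) ^ 2) ≤ R ^ 2) :
    ∃ ε : ℝ, 0 < ε ∧ ∀ x : PhaseSpace N, h₁ ≤ (limitChain lam β).hamiltonian N x →
      (limitChain lam β).hamiltonian N x ≤ h₀ → (∀ i, |x.1 i| ≤ ρ) →
        ε ≤ limitDissipation lam β N hR Λ x := by
  set H := (limitChain lam β).hamiltonian N with hH
  set C : Set (PhaseSpace N) := {x | h₁ ≤ H x ∧ H x ≤ h₀ ∧ ∀ i, |x.1 i| ≤ ρ} with hC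
  have hHc : Continuous H := (limitChain_contDiff_hamiltonian lam β N (n := 0)).continuous
  have hclosed : IsClosed C := by
    have h1 : IsClosed {x : PhaseSpace N | h₁ ≤ H x} := isClosed_le continuous_const hHc
    have h2 : IsClosed {x : PhaseSpace N | H x ≤ h₀} := isClosed_le hHc continuous_const
    have h3 : IsClosed {x : PhaseSpace N | ∀ i, |x.1 i| ≤ ρ} := by
      have : {x : PhaseSpace N | ∀ i, |x.1 i| ≤ ρ} = ⋂ i, {x | |x.1 i| ≤ ρ} := by ext; simp
      rw [this]
      exact isClosed_iInter fun i => isClosed_le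
        (continuous_abs.comp ((continuous_apply i).comp continuous_fst)) continuous_const
    have hCeq : C = {x : PhaseSpace N | h₁ ≤ H x} ∩ ({x | H x ≤ h₀} ∩ {x | ∀ i, |x.1 i| ≤ ρ}) := by
      ext x; simp [hC]
    rw [hCeq]
    exact h1.inter (h2.inter h3)
  have hbdd : C ⊆ closedBall (0 : PhaseSpace N) (max ρ (h₀ + 1 / 2)) := by
    intro x hx
    rw [mem_closedBall, dist_zero_right, Prod.norm_def, max_le_iff]
    constructor
    · refine (pi_norm_le_iff_of_nonneg (le_max_of_le_right ?_)).2 fun i => ?_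
      · have := limitChain_abs_momentum_le hl hβ.le N x ⟨0, hN⟩
        linarith [abs_nonneg (x.2 ⟨0, hN⟩), hx.2.1]
      · rw [Real.norm_eq_abs]; exact (hx.2.2 i).trans (le_max_left _ _)
    · refine (pi_norm_le_iff_of_nonneg (le_max_of_le_right ?_)).2 fun i => ?_
      · have := limitChain_abs_momentum_le hl hβ.le N x ⟨0, hN⟩
        linarith [abs_nonneg (x.2 ⟨0, hN⟩), hx.2.1]
      · rw [Real.norm_eq_abs]
        exact ((limitChain_abs_momentum_le hl hβ.le N x i).trans (by linarith [hx.2.1])).trans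
          (le_max_right _ _)
  have hcpt : IsCompact C := (isCompact_closedBall _ _).of_isClosed_subset hclosed hbdd
  by_cases hne : C.Nonempty
  · obtain ⟨x₀, hx₀, hmin⟩ := hcpt.exists_isMinOn hne (continuous_limitDissipation lam β N hR Λ).continuousOn
    refine ⟨limitDissipation lam β N hR Λ x₀,
      limitDissipation_pos N hR hl hβ hN hΛ hRad hx₀.2.1 hx₀.2.2 (hh₁.trans_le hx₀.1), ?_⟩
    intro x h1 h2 h3
    exact (isMinOn_iff.1 hmin) x ⟨h1, h2, h3⟩
  · refine ⟨1, one_pos, fun x h1 h2 h3 => ?_⟩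
    exact (hne ⟨x, h1, h2, h3⟩).elim

end Dissipation

end Literature.MathematicalPhysics.KineticTheory.HeatConduction
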